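import Summits.HodgeConjecture.CorCM.Census.CyclicCharacterFibreWalk
import Summits.HodgeConjecture.CorCM.Census.CyclicCharacterFlipOrbitMeta

/-!
# Cyclic characters, XV: THE QUARTIC META THEOREMS (`k = 2`) — a cover, the bottom-walk faces and a count give `μ(G, c) = φ₂(G, c)`

COR-CM (cell `pub-hodgecm2`), count-neutral kernel combinatorics by the binder seat b09 (gen 42; lane CYCLIC-CHARACTER FIBRE LAW, part XV), on parts XIII
(`Census/CyclicCharacterFlipOrbitMeta.lean`: the repaired META theorems) and XIV (`Census/CyclicCharacterFibreWalk.lean`: (fib) and the top flips from the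
bottom walk) BY NAME.  Theorems only (no definition, no `decide` beyond one numeral identity in `ℤ/4`, no certificate, no named fact, no `sorry`).
HONEST FRAMING: `HC_CM` is NOT proved, here or anywhere in the tree; nothing here is a period or a headline.

For `k = 2` (`G / ker w ≅ ℤ/4`: the dicyclic groups `Dic_m = ℤ/m ⋊ ℤ/4`, the cyclic `ℤ/4m`, `ℤ/4 ⋊ ℤ/4` with `c = y²`, `Q₈ ×_ε ℤ/4`, …) the arc type
`T_0 = w⁻¹{0, 1}` has only a BOTTOM fibre (`w = 0`, whose flips lie in the flip orbit) and a TOP fibre (`w = 1 = 2ᵏ⁻¹ − 1`, whose flips the walk relation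
(W1) expresses through bottom flips and arc types), so the repaired hypotheses (flip′) and (fib) of part XIII hold with exponent `0` as soon as
`ℤ⟨pairs⟩ + ℤ[G]·S₀` contains the faces of the bottom walk (`hflip_of_walkFaces_le_of_two`, part XIV `fibreSum_mem_of_walkFaces_le`):

* `isLeast_card_gfaces_generate_of_walk_isPGroup` (2-groups), `…_of_walk_rel` (`G = ι(Γ)·⟨N⟩`), `…_of_walk_supported` (any `G`):
  **`μ(G, c) = φ₂(G, c)`** from a fibre-independent face family `S₀` containing a cover of the arc block (every type reduces integrally to potential `≤ 1`)
  and generating, with the pairs, the faces of the Boolean lattice `2^{F_0}` between `T_0` and `T_1` (plus, off `2`-groups, the `N`-coboundary / near-zone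
  condition mod `2`).  What a `k = 2` column owes is therefore a statement about ONE Boolean lattice with its `ker w`-symmetry and a parity count.

## References
* [Pohlmann1968] H. Pohlmann, Algebraic cycles on abelian varieties of complex multiplication type, Ann. of Math. 88 (1968), Thm 1.
* [Milne1999] J. S. Milne, Lefschetz motives and the Tate conjecture, Compositio Math. 117 (1999), Prop. 2.1, p. 54.
-/

namespace Summit.HodgeConjecture.CorCM.Census.CyclicCharacter

open Finset
open Summit.HodgeConjecture.CorCM.Prior.AllgGroup.RfwfAllgGroup
open Summit.HodgeConjecture.CorCM.Census.BlockParity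
open Summit.HodgeConjecture.CorCM.Census.Coinvariant
open Summit.HodgeConjecture.CorCM.Census.BaseBlock
open Summit.HodgeConjecture.CorCM.Census.Splitting

noncomputable section

variable {G : Type*} [Group G] [Fintype G] [DecidableEq G] {k : ℕ} {w : G → ZMod (2 ^ k)} {c : G}

/-! ## The quartic META theorems (`k = 2`) -/

/-- For `k = 2` a point of `T_0` is a bottom point (`w s = 0`) or a top point (`w s = 2ᵏ⁻¹ − 1 = 1`). [folklore] -/
theorem apply_eq_zero_or_eq_top_of_two (hw : ∀ P Q : G, w (P * Q) = w P + w Q) (hk : 1 ≤ k) (hk2 : k = 2) (hc2 : c * c = 1)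
    (hwc : w c ≠ 0) {s : G} (hs : s ∈ (arcType hw hk hc2 hwc 0).1) : w s = 0 ∨ w s = ((2 ^ (k - 1) : ℕ) : ZMod (2 ^ k)) - 1 := by
  subst hk2
  rw [mem_arcType, sub_zero] at hs
  have hv : (w s).val = 0 ∨ (w s).val = 1 := by
    have : (w s).val < 2 := by simpa using hs
    omega
  rcases hv with h | h
  · exact Or.inl ((ZMod.val_eq_zero _).mp h)
  · right
    rw [← ZMod.natCast_zmod_val (w s), h]
    decide

/-- **(flip′) holds with exponent `0` for `k = 2`** when `ℤ⟨pairs⟩ + ℤ[G]·S` contains the walk relations (W1) (flip orbit of `T_0^{(1)}`). [folklore] -/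
theorem hflip_of_rel_of_two (hw : ∀ P Q : G, w (P * Q) = w P + w Q) (hk : 1 ≤ k) (hk2 : k = 2) (hc2 : c * c = 1)
    (hcen : ∀ x : G, x * c = c * x) (hwc : w c ≠ 0) (h1 : ∃ g₁ : G, w g₁ = 1) (S : Finset (CMF G c →₀ ℤ))
    (hR1 : ∀ t : G, w t = 0 → Finsupp.single (oflipCM c hc2 t (arcType hw hk hc2 hwc 1)) (1 : ℤ) -
      ((∑ s ∈ (univ.filter fun s => w s = 0).erase t,
        (Finsupp.single (oflipCM c hc2 s (arcType hw hk hc2 hwc 0)) (1 : ℤ) - Finsupp.single (arcType hw hk hc2 hwc 0) 1)) +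
          Finsupp.single (arcType hw hk hc2 hwc 0) 1) ∈ Submodule.span ℤ (pairSet c) ⊔ Submodule.span ℤ (translates c S)) :
    ∀ s ∈ (arcType hw hk hc2 hwc 0).1, ((2 : ℤ) ^ 0) • Finsupp.single (oflipCM c hc2 s (arcType hw hk hc2 hwc 0)) (1 : ℤ) ∈
      ((Submodule.span ℤ (pairSet c) ⊔ Submodule.span ℤ (translates c S)) ⊔
        Submodule.span ℤ (Set.range fun Q : G => Finsupp.single (rt c Q (arcType hw hk hc2 hwc 0)) (1 : ℤ))) ⊔
          Submodule.span ℤ (Set.range fun Q : G => Finsupp.single (rt c Q (oflipCM c hc2 1 (arcType hw hk hc2 hwc 0))) (1 : ℤ)) := by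
  intro s hs
  rcases apply_eq_zero_or_eq_top_of_two hw hk hk2 hc2 hwc hs with h | h
  · exact single_oflipCM_mem_flipTarget_of_apply_eq hw hk hc2 hwc S (h.trans (map_one hw).symm) 0
  · rw [pow_zero, one_smul]
    exact single_oflipCM_top_mem_flipTarget_of_rel hw hk hc2 hcen hwc h1 S hR1 (map_one hw) h

/-- **(flip′) holds with exponent `0` for `k = 2`** when `ℤ⟨pairs⟩ + ℤ[G]·S` contains the bottom-walk faces (flip orbit of `T_0^{(1)}`). [folklore] -/
theorem hflip_of_walkFaces_le_of_two (hw : ∀ P Q : G, w (P * Q) = w P + w Q) (hk : 1 ≤ k) (hk2 : k = 2) (hc2 : c * c = 1)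
    (hcen : ∀ x : G, x * c = c * x) (hwc : w c ≠ 0) (h1 : ∃ g₁ : G, w g₁ = 1) (S : Finset (CMF G c →₀ ℤ))
    (hW : Submodule.span ℤ {y : CMF G c →₀ ℤ | ∃ (Φ' : CMF G c) (s s' : G),
        (arcType hw hk hc2 hwc 0).1 \ Φ'.1 ⊆ (univ.filter fun s => w s = 0) ∧ s ∈ (arcType hw hk hc2 hwc 0).1 \ Φ'.1 ∧
          s' ∈ (arcType hw hk hc2 hwc 0).1 \ Φ'.1 ∧ s ≠ s' ∧ y = gface c hc2 Φ' s s'} ≤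
        Submodule.span ℤ (pairSet c) ⊔ Submodule.span ℤ (translates c S)) :
    ∀ s ∈ (arcType hw hk hc2 hwc 0).1, ((2 : ℤ) ^ 0) • Finsupp.single (oflipCM c hc2 s (arcType hw hk hc2 hwc 0)) (1 : ℤ) ∈
      ((Submodule.span ℤ (pairSet c) ⊔ Submodule.span ℤ (translates c S)) ⊔
        Submodule.span ℤ (Set.range fun Q : G => Finsupp.single (rt c Q (arcType hw hk hc2 hwc 0)) (1 : ℤ))) ⊔
          Submodule.span ℤ (Set.range fun Q : G => Finsupp.single (rt c Q (oflipCM c hc2 1 (arcType hw hk hc2 hwc 0))) (1 : ℤ)) :=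
  hflip_of_rel_of_two hw hk hk2 hc2 hcen hwc h1 S fun _ ht => hW (single_oflipCM_arcType_one_sub_mem_span_walkFaces hw hk hc2 hwc ht)

/-! ## The quartic META theorems from the two walk relations -/

/-- **QUARTIC META THEOREM FOR 2-GROUPS, relation form (`k = 2`): `μ(G, c) = φ₂(G, c)`** from a fibre-independent face family containing a cover of the
arc block whose `ℤ[G]`-span with the pairs contains the walk relations (W1) (all `t` with `w t = 0`) and (W2). [folklore] -/
theorem isLeast_card_gfaces_generate_of_walkRel_isPGroup [Fintype (CMF G c)] (hG : IsPGroup 2 G) (hw : ∀ P Q : G, w (P * Q) = w P + w Q)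
    (hk : 1 ≤ k) (hk2 : k = 2) (hc2 : c * c = 1) (hcen : ∀ x : G, x * c = c * x) (hwc : w c ≠ 0) (h1 : ∃ g₁ : G, w g₁ = 1)
    (S₀ : Finset (CMF G c →₀ ℤ)) (hS₀ : (↑S₀ : Set (CMF G c →₀ ℤ)) ⊆ gfaceSet G c hc2)
    (hli : LinearIndepOn (ZMod 2) (fun f : CMF G c →₀ ℤ => (rad2 c hc2).mkQ (red c f)) ↑S₀)
    (hcov : ∀ Φ : CMF G c, Finsupp.single Φ (1 : ℤ) ∈
      (Submodule.span ℤ (pairSet c) ⊔ Submodule.span ℤ (translates c S₀)) ⊔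
        Submodule.span ℤ ((fun Ψ => Finsupp.single Ψ (1 : ℤ)) '' {Ψ : CMF G c | bpot c (arcType hw hk hc2 hwc 0) Ψ ≤ 1}))
    (hR1 : ∀ t : G, w t = 0 → Finsupp.single (oflipCM c hc2 t (arcType hw hk hc2 hwc 1)) (1 : ℤ) -
      ((∑ s ∈ (univ.filter fun s => w s = 0).erase t,
        (Finsupp.single (oflipCM c hc2 s (arcType hw hk hc2 hwc 0)) (1 : ℤ) - Finsupp.single (arcType hw hk hc2 hwc 0) 1)) +
          Finsupp.single (arcType hw hk hc2 hwc 0) 1) ∈ Submodule.span ℤ (pairSet c) ⊔ Submodule.span ℤ (translates c S₀))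
    (hR2 : (∑ s ∈ univ.filter (fun s => w s = 0), Finsupp.single (oflipCM c hc2 s (arcType hw hk hc2 hwc 0)) (1 : ℤ)) -
      Finsupp.single (arcType hw hk hc2 hwc 1) (1 : ℤ) -
        (((univ.filter fun s => w s = 0).card : ℤ) - 1) • Finsupp.single (arcType hw hk hc2 hwc 0) (1 : ℤ) ∈ Submodule.span ℤ (pairSet c) ⊔ Submodule.span ℤ (translates c S₀)) :
    IsLeast {n : ℕ | ∃ S : Finset (CMF G c →₀ ℤ), (↑S ⊆ gfaceSet G c hc2) ∧ S.card = n ∧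
      hodgeSpan c hc2 ≤ Submodule.span ℤ (pairSet c) ⊔ Submodule.span ℤ (translates c S)} (fibreTwo c hc2) :=
  isLeast_card_gfaces_generate_of_flipCert_isPGroup hG hw hk hc2 hcen hwc h1 (one_mem_arcType_zero hw hk hc2 hwc) S₀ hS₀ hli 0 0 hcov
    (hflip_of_rel_of_two hw hk hk2 hc2 hcen hwc h1 S₀ hR1) (fibreSum_mem_of_rel hw hk hc2 hwc h1 _ hR2 (map_one hw))

/-- **QUARTIC META THEOREM, RELATIVE FORM, relation form (`k = 2`, `G = ι(Γ)·⟨N⟩`, `Γ` a `2`-group — `Dic_m`, `ℤ/4m`, …).** [folklore] -/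
theorem isLeast_card_gfaces_generate_of_walkRel_rel [Fintype (CMF G c)] {Γ : Type*} [Group Γ] (hΓ : IsPGroup 2 Γ) (ι : Γ →* G) (N : Set G)
    (hfac : ∀ Q : G, ∃ γ : Γ, ∃ n ∈ Subgroup.closure N, Q = ι γ * n)
    (hw : ∀ P Q : G, w (P * Q) = w P + w Q) (hk : 1 ≤ k) (hk2 : k = 2) (hc2 : c * c = 1) (hcen : ∀ x : G, x * c = c * x) (hwc : w c ≠ 0)
    (h1 : ∃ g₁ : G, w g₁ = 1) (S₀ : Finset (CMF G c →₀ ℤ)) (hS₀ : (↑S₀ : Set (CMF G c →₀ ℤ)) ⊆ gfaceSet G c hc2)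
    (hli : LinearIndepOn (ZMod 2) (fun f : CMF G c →₀ ℤ => (rad2 c hc2).mkQ (red c f)) ↑S₀)
    (hN : ∀ n ∈ N, ∀ f ∈ gfaceSet G c hc2, red c (Finsupp.mapDomain (rt c n) f - f) ∈
      pair2 c ⊔ Submodule.span (ZMod 2) (translates2 c (S₀.image (red c))))
    (hcov : ∀ Φ : CMF G c, Finsupp.single Φ (1 : ℤ) ∈
      (Submodule.span ℤ (pairSet c) ⊔ Submodule.span ℤ (translates c S₀)) ⊔
        Submodule.span ℤ ((fun Ψ => Finsupp.single Ψ (1 : ℤ)) '' {Ψ : CMF G c | bpot c (arcType hw hk hc2 hwc 0) Ψ ≤ 1}))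
    (hR1 : ∀ t : G, w t = 0 → Finsupp.single (oflipCM c hc2 t (arcType hw hk hc2 hwc 1)) (1 : ℤ) -
      ((∑ s ∈ (univ.filter fun s => w s = 0).erase t,
        (Finsupp.single (oflipCM c hc2 s (arcType hw hk hc2 hwc 0)) (1 : ℤ) - Finsupp.single (arcType hw hk hc2 hwc 0) 1)) +
          Finsupp.single (arcType hw hk hc2 hwc 0) 1) ∈ Submodule.span ℤ (pairSet c) ⊔ Submodule.span ℤ (translates c S₀))
    (hR2 : (∑ s ∈ univ.filter (fun s => w s = 0), Finsupp.single (oflipCM c hc2 s (arcType hw hk hc2 hwc 0)) (1 : ℤ)) -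
      Finsupp.single (arcType hw hk hc2 hwc 1) (1 : ℤ) -
        (((univ.filter fun s => w s = 0).card : ℤ) - 1) • Finsupp.single (arcType hw hk hc2 hwc 0) (1 : ℤ) ∈ Submodule.span ℤ (pairSet c) ⊔ Submodule.span ℤ (translates c S₀)) :
    IsLeast {n : ℕ | ∃ S : Finset (CMF G c →₀ ℤ), (↑S ⊆ gfaceSet G c hc2) ∧ S.card = n ∧
      hodgeSpan c hc2 ≤ Submodule.span ℤ (pairSet c) ⊔ Submodule.span ℤ (translates c S)} (fibreTwo c hc2) :=
  isLeast_card_gfaces_generate_of_flipCert_rel hΓ ι N hfac hw hk hc2 hcen hwc h1 (one_mem_arcType_zero hw hk hc2 hwc) S₀ hS₀ hli hN 0 0 hcov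
    (hflip_of_rel_of_two hw hk hk2 hc2 hcen hwc h1 S₀ hR1) (fibreSum_mem_of_rel hw hk hc2 hwc h1 _ hR2 (map_one hw))

/-- **QUARTIC META THEOREM, GROUP-FREE FORM, relation form (`k = 2`, any finite `G`): `|S₀| = φ₂(G, c)` and `μ(G, c) = φ₂(G, c)`.** [folklore] -/
theorem isLeast_card_gfaces_generate_of_walkRel_supported [Fintype (CMF G c)] (hw : ∀ P Q : G, w (P * Q) = w P + w Q) (hk : 1 ≤ k)
    (hk2 : k = 2) (hc2 : c * c = 1) (hcen : ∀ x : G, x * c = c * x) (hwc : w c ≠ 0) (h1 : ∃ g₁ : G, w g₁ = 1)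
    (S₀ : Finset (CMF G c →₀ ℤ)) (hS₀ : (↑S₀ : Set (CMF G c →₀ ℤ)) ⊆ gfaceSet G c hc2)
    (hli : LinearIndepOn (ZMod 2) (fun f : CMF G c →₀ ℤ => (rad2 c hc2).mkQ (red c f)) ↑S₀)
    (hcov : ∀ Φ : CMF G c, Finsupp.single Φ (1 : ℤ) ∈
      (Submodule.span ℤ (pairSet c) ⊔ Submodule.span ℤ (translates c S₀)) ⊔
        Submodule.span ℤ ((fun Ψ => Finsupp.single Ψ (1 : ℤ)) '' {Ψ : CMF G c | bpot c (arcType hw hk hc2 hwc 0) Ψ ≤ 1}))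
    (hres : ∀ y ∈ hodge2 c hc2, y ∈ Finsupp.supported (ZMod 2) (ZMod 2) {Ψ : CMF G c | bpot c (arcType hw hk hc2 hwc 0) Ψ ≤ 1} →
      y ∈ pair2 c ⊔ Submodule.span (ZMod 2) (translates2 c (S₀.image (red c))))
    (hR1 : ∀ t : G, w t = 0 → Finsupp.single (oflipCM c hc2 t (arcType hw hk hc2 hwc 1)) (1 : ℤ) -
      ((∑ s ∈ (univ.filter fun s => w s = 0).erase t,
        (Finsupp.single (oflipCM c hc2 s (arcType hw hk hc2 hwc 0)) (1 : ℤ) - Finsupp.single (arcType hw hk hc2 hwc 0) 1)) +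
          Finsupp.single (arcType hw hk hc2 hwc 0) 1) ∈ Submodule.span ℤ (pairSet c) ⊔ Submodule.span ℤ (translates c S₀))
    (hR2 : (∑ s ∈ univ.filter (fun s => w s = 0), Finsupp.single (oflipCM c hc2 s (arcType hw hk hc2 hwc 0)) (1 : ℤ)) -
      Finsupp.single (arcType hw hk hc2 hwc 1) (1 : ℤ) -
        (((univ.filter fun s => w s = 0).card : ℤ) - 1) • Finsupp.single (arcType hw hk hc2 hwc 0) (1 : ℤ) ∈ Submodule.span ℤ (pairSet c) ⊔ Submodule.span ℤ (translates c S₀)) :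
    S₀.card = fibreTwo c hc2 ∧
    IsLeast {n : ℕ | ∃ S : Finset (CMF G c →₀ ℤ), (↑S ⊆ gfaceSet G c hc2) ∧ S.card = n ∧
      hodgeSpan c hc2 ≤ Submodule.span ℤ (pairSet c) ⊔ Submodule.span ℤ (translates c S)} (fibreTwo c hc2) :=
  isLeast_card_gfaces_generate_of_flipCert_supported hw hk hc2 hcen hwc h1 (one_mem_arcType_zero hw hk hc2 hwc) S₀ hS₀ hli 0 0 hcov hres
    (hflip_of_rel_of_two hw hk hk2 hc2 hcen hwc h1 S₀ hR1) (fibreSum_mem_of_rel hw hk hc2 hwc h1 _ hR2 (map_one hw))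

/-! ## The quartic META theorems from the bottom-walk faces -/

/-- **QUARTIC META THEOREM FOR 2-GROUPS (`k = 2`: `ℤ/4 ⋊ ℤ/4`, `Q₈ ×_ε ℤ/4`, `ℤ/2ʲ·4`-type quotients …): `μ(G, c) = φ₂(G, c)`** from a fibre-independent
face family containing a cover of the arc block whose `ℤ[G]`-span together with the pairs contains the faces of the bottom walk. [folklore] -/
theorem isLeast_card_gfaces_generate_of_walk_isPGroup [Fintype (CMF G c)] (hG : IsPGroup 2 G) (hw : ∀ P Q : G, w (P * Q) = w P + w Q)
    (hk : 1 ≤ k) (hk2 : k = 2) (hc2 : c * c = 1) (hcen : ∀ x : G, x * c = c * x) (hwc : w c ≠ 0) (h1 : ∃ g₁ : G, w g₁ = 1)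
    (S₀ : Finset (CMF G c →₀ ℤ)) (hS₀ : (↑S₀ : Set (CMF G c →₀ ℤ)) ⊆ gfaceSet G c hc2)
    (hli : LinearIndepOn (ZMod 2) (fun f : CMF G c →₀ ℤ => (rad2 c hc2).mkQ (red c f)) ↑S₀)
    (hcov : ∀ Φ : CMF G c, Finsupp.single Φ (1 : ℤ) ∈
      (Submodule.span ℤ (pairSet c) ⊔ Submodule.span ℤ (translates c S₀)) ⊔
        Submodule.span ℤ ((fun Ψ => Finsupp.single Ψ (1 : ℤ)) '' {Ψ : CMF G c | bpot c (arcType hw hk hc2 hwc 0) Ψ ≤ 1}))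
    (hW : Submodule.span ℤ {y : CMF G c →₀ ℤ | ∃ (Φ' : CMF G c) (s s' : G),
        (arcType hw hk hc2 hwc 0).1 \ Φ'.1 ⊆ (univ.filter fun s => w s = 0) ∧ s ∈ (arcType hw hk hc2 hwc 0).1 \ Φ'.1 ∧
          s' ∈ (arcType hw hk hc2 hwc 0).1 \ Φ'.1 ∧ s ≠ s' ∧ y = gface c hc2 Φ' s s'} ≤
        Submodule.span ℤ (pairSet c) ⊔ Submodule.span ℤ (translates c S₀)) :
    IsLeast {n : ℕ | ∃ S : Finset (CMF G c →₀ ℤ), (↑S ⊆ gfaceSet G c hc2) ∧ S.card = n ∧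
      hodgeSpan c hc2 ≤ Submodule.span ℤ (pairSet c) ⊔ Submodule.span ℤ (translates c S)} (fibreTwo c hc2) :=
  isLeast_card_gfaces_generate_of_flipCert_isPGroup hG hw hk hc2 hcen hwc h1 (one_mem_arcType_zero hw hk hc2 hwc) S₀ hS₀ hli 0 0 hcov
    (hflip_of_walkFaces_le_of_two hw hk hk2 hc2 hcen hwc h1 S₀ hW)
    (fibreSum_mem_of_walkFaces_le hw hk hc2 hwc h1 _ hW (map_one hw))

/-- **QUARTIC META THEOREM, RELATIVE FORM (`k = 2`, any `G = ι(Γ)·⟨N⟩` with `Γ` a `2`-group: the dicyclic groups `Dic_m = ℤ/m ⋊ ℤ/4`, `ℤ/4m`, …):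
`μ(G, c) = φ₂(G, c)`** from a fibre-independent cover-containing face family generating the bottom-walk faces and the `N`-coboundaries mod `2`. [folklore] -/
theorem isLeast_card_gfaces_generate_of_walk_rel [Fintype (CMF G c)] {Γ : Type*} [Group Γ] (hΓ : IsPGroup 2 Γ) (ι : Γ →* G) (N : Set G)
    (hfac : ∀ Q : G, ∃ γ : Γ, ∃ n ∈ Subgroup.closure N, Q = ι γ * n)
    (hw : ∀ P Q : G, w (P * Q) = w P + w Q) (hk : 1 ≤ k) (hk2 : k = 2) (hc2 : c * c = 1) (hcen : ∀ x : G, x * c = c * x) (hwc : w c ≠ 0)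
    (h1 : ∃ g₁ : G, w g₁ = 1) (S₀ : Finset (CMF G c →₀ ℤ)) (hS₀ : (↑S₀ : Set (CMF G c →₀ ℤ)) ⊆ gfaceSet G c hc2)
    (hli : LinearIndepOn (ZMod 2) (fun f : CMF G c →₀ ℤ => (rad2 c hc2).mkQ (red c f)) ↑S₀)
    (hN : ∀ n ∈ N, ∀ f ∈ gfaceSet G c hc2, red c (Finsupp.mapDomain (rt c n) f - f) ∈
      pair2 c ⊔ Submodule.span (ZMod 2) (translates2 c (S₀.image (red c))))
    (hcov : ∀ Φ : CMF G c, Finsupp.single Φ (1 : ℤ) ∈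
      (Submodule.span ℤ (pairSet c) ⊔ Submodule.span ℤ (translates c S₀)) ⊔
        Submodule.span ℤ ((fun Ψ => Finsupp.single Ψ (1 : ℤ)) '' {Ψ : CMF G c | bpot c (arcType hw hk hc2 hwc 0) Ψ ≤ 1}))
    (hW : Submodule.span ℤ {y : CMF G c →₀ ℤ | ∃ (Φ' : CMF G c) (s s' : G),
        (arcType hw hk hc2 hwc 0).1 \ Φ'.1 ⊆ (univ.filter fun s => w s = 0) ∧ s ∈ (arcType hw hk hc2 hwc 0).1 \ Φ'.1 ∧
          s' ∈ (arcType hw hk hc2 hwc 0).1 \ Φ'.1 ∧ s ≠ s' ∧ y = gface c hc2 Φ' s s'} ≤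
        Submodule.span ℤ (pairSet c) ⊔ Submodule.span ℤ (translates c S₀)) :
    IsLeast {n : ℕ | ∃ S : Finset (CMF G c →₀ ℤ), (↑S ⊆ gfaceSet G c hc2) ∧ S.card = n ∧
      hodgeSpan c hc2 ≤ Submodule.span ℤ (pairSet c) ⊔ Submodule.span ℤ (translates c S)} (fibreTwo c hc2) :=
  isLeast_card_gfaces_generate_of_flipCert_rel hΓ ι N hfac hw hk hc2 hcen hwc h1 (one_mem_arcType_zero hw hk hc2 hwc) S₀ hS₀ hli hN 0 0 hcov
    (hflip_of_walkFaces_le_of_two hw hk hk2 hc2 hcen hwc h1 S₀ hW)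
    (fibreSum_mem_of_walkFaces_le hw hk hc2 hwc h1 _ hW (map_one hw))

/-- **QUARTIC META THEOREM, GROUP-FREE FORM (`k = 2`, any finite `G`): `|S₀| = φ₂(G, c)` and `μ(G, c) = φ₂(G, c)`** from a fibre-independent
cover-containing face family generating the bottom-walk faces and, mod `2`, the Hodge vectors supported on the near zone. [folklore] -/
theorem isLeast_card_gfaces_generate_of_walk_supported [Fintype (CMF G c)] (hw : ∀ P Q : G, w (P * Q) = w P + w Q) (hk : 1 ≤ k)
    (hk2 : k = 2) (hc2 : c * c = 1) (hcen : ∀ x : G, x * c = c * x) (hwc : w c ≠ 0) (h1 : ∃ g₁ : G, w g₁ = 1)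
    (S₀ : Finset (CMF G c →₀ ℤ)) (hS₀ : (↑S₀ : Set (CMF G c →₀ ℤ)) ⊆ gfaceSet G c hc2)
    (hli : LinearIndepOn (ZMod 2) (fun f : CMF G c →₀ ℤ => (rad2 c hc2).mkQ (red c f)) ↑S₀)
    (hcov : ∀ Φ : CMF G c, Finsupp.single Φ (1 : ℤ) ∈
      (Submodule.span ℤ (pairSet c) ⊔ Submodule.span ℤ (translates c S₀)) ⊔
        Submodule.span ℤ ((fun Ψ => Finsupp.single Ψ (1 : ℤ)) '' {Ψ : CMF G c | bpot c (arcType hw hk hc2 hwc 0) Ψ ≤ 1}))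
    (hres : ∀ y ∈ hodge2 c hc2, y ∈ Finsupp.supported (ZMod 2) (ZMod 2) {Ψ : CMF G c | bpot c (arcType hw hk hc2 hwc 0) Ψ ≤ 1} →
      y ∈ pair2 c ⊔ Submodule.span (ZMod 2) (translates2 c (S₀.image (red c))))
    (hW : Submodule.span ℤ {y : CMF G c →₀ ℤ | ∃ (Φ' : CMF G c) (s s' : G),
        (arcType hw hk hc2 hwc 0).1 \ Φ'.1 ⊆ (univ.filter fun s => w s = 0) ∧ s ∈ (arcType hw hk hc2 hwc 0).1 \ Φ'.1 ∧
          s' ∈ (arcType hw hk hc2 hwc 0).1 \ Φ'.1 ∧ s ≠ s' ∧ y = gface c hc2 Φ' s s'} ≤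
        Submodule.span ℤ (pairSet c) ⊔ Submodule.span ℤ (translates c S₀)) :
    S₀.card = fibreTwo c hc2 ∧
    IsLeast {n : ℕ | ∃ S : Finset (CMF G c →₀ ℤ), (↑S ⊆ gfaceSet G c hc2) ∧ S.card = n ∧
      hodgeSpan c hc2 ≤ Submodule.span ℤ (pairSet c) ⊔ Submodule.span ℤ (translates c S)} (fibreTwo c hc2) :=
  isLeast_card_gfaces_generate_of_flipCert_supported hw hk hc2 hcen hwc h1 (one_mem_arcType_zero hw hk hc2 hwc) S₀ hS₀ hli 0 0 hcov hres
    (hflip_of_walkFaces_le_of_two hw hk hk2 hc2 hcen hwc h1 S₀ hW)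
    (fibreSum_mem_of_walkFaces_le hw hk hc2 hwc h1 _ hW (map_one hw))

end

end Summit.HodgeConjecture.CorCM.Census.CyclicCharacter
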